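import Literature.AlgebraicGeometry.ComplexMultiplication.EndomorphismFieldHarrisTaylorSignature
import Literature.NumberTheory.ComplexMultiplication.CMTypeHarrisTaylorSignatureReflexFieldCompositum
import HarnessLib

/-!
# The reflex field of a CM point of the Rapoport–Smithling–Zhang moduli problem: for Shimura's pair `(A, ι : F → End⁰A)`
# with the Kottwitz condition of signature `((1, n−1)_{φ₀}, (0, n)_{φ ∈ Φ₀ ∖ {φ₀}})` on `Lie(A)` (`K₀ ≤ F` of ANY degree,
# `n = [F : K₀] ≥ 3`, `F` CM), `K* = E_{Φ₀} · σ₀(F)`, which contains RSZ's reflex field `E = E_{Φ₀} · φ₀(K₀)`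

Topic `Literature/AlgebraicGeometry/ComplexMultiplication` (family `hodge`, lane `lit-hodgefound`; the ALGEBRAIC
carrier `Motives.AbelianVariety ℂ`, Shimura's pairs `(A, ι : F →+* A.endAlgebra)`, `[F : ℚ] = 2 dim A`, THE type
`Φ = cmTypeOfPair ι hF`, a subfield `K₀ ≤ F`, `n = [F : K₀]`, `m_ψ = #{φ ∈ Φ ∣ φ|_{K₀} = ψ}`).  Seat `lit-hodgefound-p11`,
generation 28, row g28-#3: the pair-level transport of the field-level
`NumberTheory/ComplexMultiplication/CMTypeHarrisTaylorSignatureReflexFieldCompositum` (g28-#2: `K* = E_{Φ₀} · σ₀(K)` and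
`Stab(Φ) = Stab(Φ₀) ∩ Stab(σ₀)` for a CM type with the Kottwitz condition relative to `(Φ₀, φ₀)`) through the dictionary
of `EndomorphismFieldHarrisTaylorSignature` (g27-#5: RSZ's DISPLAYED Kottwitz condition on `Lie(A)` ⟺ `m_{φ₀} = 1` and
`m_φ = 0` on `Φ₀ ∖ {φ₀}`; there: `σ₀(F) ⊆ K*`, and `K* = σ₀(F)` for `K₀/ℚ` normal).  THEOREMS ONLY (D-0026): no
definition, no named fact, no instance.

PRINTED STATEMENTS.  M. Rapoport, B. Smithling, W. Zhang, *Arithmetic diagonal cycles on unitary Shimura varieties*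
(Compositio 2020) [RapoportSmithlingZhang2017], arXiv:1710.06962v3: §3.1 p. 9 eq. (3.1) «common reflex field `E ⊂ ℂ`
characterized by `Aut(ℂ/E) = {σ ∈ Aut(ℂ) ∣ σΦ = Φ and σφ₀ = φ₀}`», Remark 3.1 (i) («`E_Φ ⊂ E`»), §3.2 p. 10 (the
moduli problem over `Spec E`): «`A` is an abelian scheme over `S` with an `F`-action `ι : F → End⁰(A)` satisfying the
Kottwitz condition of signature `((1, n−1)_{φ₀}, (0, n)_{φ ∈ Φ ∖ {φ₀}})`, i.e.
`char(ι(a) ∣ Lie A) = (T − φ₀(a))(T − φ̄₀(a))^{n−1} ∏_{φ ∈ Φ ∖ {φ₀}} (T − φ̄(a))ⁿ` for all `a`».  B. Howard (2012)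
[Howard2012] §3.1: «`K_Φ = φ^{sp}(K)`» (`K₀` imaginary quadratic — the case `E_{Φ₀} = φ₀(K₀) ⊆ σ₀(F)`).  G. Shimura
(1998) [Shimura1998] §5.2 p. 39, §8.3 Prop. 28.

WHAT IS PROVED (`K₀ : IntermediateField ℚ F`, `Φ₀ : CMType K₀`, `φ₀ ∈ Φ₀`, `h` = RSZ's displayed condition on `Lie(A)`
for every `a ∈ K₀`, `F` CM, `n = finrank K₀ F ≥ 3`, `σ₀ ∈ Φ` the special element above `φ₀`, which `h` provides —
g27-#5's `exists_special_of_rsz`):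

* **`traceField_cmTypeOfPair_eq_traceField_sup_fieldRange_of_rsz`** — `K* = E_{Φ₀} · σ₀(F)`: the reflex field of THE
  type of `(A, ι)` is the compositum of the reflex field of the base type and `σ₀(F) ≅ F`;
* **`traceField_sup_fieldRange_le_traceField_cmTypeOfPair_of_rsz`** — RSZ's `E = E_{Φ₀} · φ₀(K₀) ⊆ K*`, and
  `traceField_base_le_traceField_cmTypeOfPair_of_rsz` (`E_{Φ₀} ⊆ K*`);
* **`forall_smul_mem_cmTypeOfPair_iff_iff_of_rsz`** — `Stab(Φ) = Stab(Φ₀) ∩ Stab(σ₀)` in `Aut(ℂ)`, and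
  `mem_traceField_cmTypeOfPair_iff_forall_of_rsz` (`K*` is the fixed field of that subgroup);
* degrees: `two_mul_dim_dvd_finrank_traceField_of_rsz` (`2 dim A ∣ [K* : ℚ]`),
  `finrank_traceField_base_dvd_finrank_traceField_cmTypeOfPair_of_rsz` (`[E_{Φ₀} : ℚ] ∣ [K* : ℚ]`),
  `finrank_traceField_sup_fieldRange_dvd_finrank_traceField_cmTypeOfPair_of_rsz` (`[E : ℚ] ∣ [K* : ℚ]`),
  `finrank_traceField_cmTypeOfPair_le_of_rsz` (`[K* : ℚ] ≤ [E_{Φ₀} : ℚ] · 2 dim A`);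
* `traceField_cmTypeOfPair_eq_fieldRange_iff_of_rsz` (`K* = σ₀(F) ⟺ E_{Φ₀} ⊆ σ₀(F)`, refining g27-#5's normal-`K₀` case);
* the same from the Harris–Taylor hypotheses in multiplicity form (`m_{φ₀} = 1`, `m_ψ ∈ {0, n}` off `{φ₀, φ̄₀}`):
  `exists_cmType_traceField_cmTypeOfPair_eq_of_harrisTaylor`, `two_mul_dim_dvd_finrank_traceField_of_harrisTaylor`.

## References
* [RapoportSmithlingZhang2017] M. Rapoport, B. Smithling, W. Zhang, *Arithmetic diagonal cycles on unitary Shimura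
  varieties*, Compositio Math. 156 (2020); arXiv:1710.06962v3 §3.1 eq. (3.1), Remark 3.1 (i), §3.2 p. 10.
* [Howard2012] B. Howard, Ann. of Math. (2) 176 (2012), §3.1.
* [Shimura1998] G. Shimura, *Abelian Varieties with Complex Multiplication and Modular Functions* (1998), §5.2 p. 39,
  §8.3 Prop. 28.
* [MilneFT2022] J. S. Milne, *Fields and Galois Theory* (2022), Prop. 1.20, Cor. 3.19.

## Provenance

Lane `lit-hodgefound` (HOME `run/shared/lean/pub/lit-hodgefound/`), prover seat `lit-hodgefound-p11` (gen 28),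
self-proposed row g28-#3 (INBOX claim 2026-08-27), pair-level companion of g28-#2.
-/

noncomputable section

namespace Literature.AlgebraicGeometry.ComplexMultiplication

open scoped Classical Polynomial Pointwise
open CategoryTheory NumberField Module Polynomial
open Literature.AlgebraicGeometry.Motives
open Literature.NumberTheory.ComplexMultiplication

namespace EndFieldFullDegree

variable {F : Type} [Field F] [NumberField F] {A : AbelianVariety ℂ}
  (ιF : F →+* A.endAlgebra) (hF : finrank ℚ F = 2 * A.dim) (K₀ : IntermediateField ℚ F)

/-! ### §0 Dictionary: multiplicities as set cardinalities, RSZ's displayed condition as `(h1, hΦ₀)` -/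

/-- The multiplicity `m_ψ` of THE type as a set cardinality (the spelling of the field-level files). [folklore] -/
private theorem ncard_inter_fibre_eq_card_fibre_rc3 (ψ : K₀ →+* ℂ) :
    {φ : F →+* ℂ | φ ∈ (cmTypeOfPair ιF hF).1 ∧ φ.comp (algebraMap K₀ F) = ψ}.ncard =
      Fintype.card {σ : (cmTypeOfPair ιF hF).1 // σ.1.comp (algebraMap K₀ F) = ψ} := by
  rw [← Nat.card_coe_set_eq, Fintype.card_eq_nat_card]
  exact Nat.card_congr
    (Equiv.subtypeSubtypeEquivSubtypeInter (fun φ : F →+* ℂ => φ ∈ (cmTypeOfPair ιF hF).1)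
      (fun φ => φ.comp (algebraMap K₀ F) = ψ)).symm

include hF in
/-- `[σ₀(F) : ℚ] = 2 dim A`. [folklore] -/
private theorem finrank_fieldRange_rc3 (s : F →+* ℂ) : finrank ℚ s.toRatAlgHom.fieldRange = 2 * A.dim := by
  rw [← hF, ← IntermediateField.finrank_eq_finrank_subalgebra, AlgHom.fieldRange_toSubalgebra]
  exact (AlgEquiv.ofInjectiveField s.toRatAlgHom).toLinearEquiv.finrank_eq.symm

section RSZ

variable (Φ₀ : CMType K₀) {φ₀ : K₀ →+* ℂ} (hφ₀ : φ₀ ∈ Φ₀.1)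
  (h : ∀ a : K₀, (Motives.AbelianVariety.lieAction A (ιF (algebraMap K₀ F a))).charpoly =
    (X - C (φ₀ a : ℂ)) * ((X - C (ComplexEmbedding.conjugate φ₀ a : ℂ)) ^ (finrank K₀ F - 1) *
      ∏ φ ∈ Φ₀.1.toFinset.erase φ₀, (X - C (ComplexEmbedding.conjugate φ a : ℂ)) ^ finrank K₀ F))

include hφ₀ h in
/-- RSZ's displayed condition gives `m_{φ₀} = 1` (set spelling). [cite: RapoportSmithlingZhang2017, §3.2] -/
private theorem h1_ncard_rc3 :
    {φ : F →+* ℂ | φ ∈ (cmTypeOfPair ιF hF).1 ∧ φ.comp (algebraMap K₀ F) = φ₀}.ncard = 1 := by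
  rw [ncard_inter_fibre_eq_card_fibre_rc3 ιF hF K₀]
  exact ((forall_charpoly_lieAction_eq_rsz_iff ιF hF K₀ Φ₀ hφ₀).1 h).1

include hφ₀ h in
/-- RSZ's displayed condition gives `m_φ = 0` on `Φ₀ ∖ {φ₀}` (set spelling). [cite: RapoportSmithlingZhang2017, §3.2] -/
private theorem hΦ₀_ncard_rc3 : ∀ ψ : K₀ →+* ℂ, ψ ∈ Φ₀.1 → ψ ≠ φ₀ →
    {φ : F →+* ℂ | φ ∈ (cmTypeOfPair ιF hF).1 ∧ φ.comp (algebraMap K₀ F) = ψ}.ncard = 0 := by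
  intro ψ hψ hne
  rw [ncard_inter_fibre_eq_card_fibre_rc3 ιF hF K₀]
  exact ((forall_charpoly_lieAction_eq_rsz_iff ιF hF K₀ Φ₀ hφ₀).1 h).2 ψ hψ hne

/-! ### §1 The stabiliser of THE type: `Stab(Φ) = Stab(Φ₀) ∩ Stab(σ₀)` -/

variable [IsCMField F]

include hφ₀ h in
/-- **`Stab(Φ) = Stab(Φ₀) ∩ Stab(σ₀)`** for THE type `Φ` of a pair with RSZ's Kottwitz condition (`n ≥ 3`, `F` CM): an
automorphism `τ` of `ℂ` stabilises `Φ` iff it stabilises the base type `Φ₀` and fixes the special element `σ₀`.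
[cite: RapoportSmithlingZhang2017, §3.1 eq. (3.1) and §3.2] [cite: Howard2012, §3.1] [cite: Shimura1998, §8.3 Prop. 28] -/
theorem forall_smul_mem_cmTypeOfPair_iff_iff_of_rsz (h3 : 3 ≤ finrank K₀ F) {σ₀ : F →+* ℂ}
    (hσ₀ : σ₀ ∈ (cmTypeOfPair ιF hF).1) (hσ₀ψ : σ₀.comp (algebraMap K₀ F) = φ₀) (τ : ℂ ≃+* ℂ) :
    (∀ χ : F →+* ℂ, τ • χ ∈ (cmTypeOfPair ιF hF).1 ↔ χ ∈ (cmTypeOfPair ιF hF).1) ↔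
      (∀ ψ : K₀ →+* ℂ, τ • ψ ∈ Φ₀.1 ↔ ψ ∈ Φ₀.1) ∧ τ • σ₀ = σ₀ :=
  forall_smul_mem_iff_iff_of_rsz K₀ hφ₀ (h1_ncard_rc3 ιF hF K₀ Φ₀ hφ₀ h) (hΦ₀_ncard_rc3 ιF hF K₀ Φ₀ hφ₀ h) h3 hσ₀ hσ₀ψ τ

/-! ### §2 The reflex field of the CM point: `K* = E_{Φ₀} · σ₀(F) ⊇ E = E_{Φ₀} · φ₀(K₀)` -/

include hφ₀ h in
/-- **`K* = E_{Φ₀} · σ₀(F)`: THE REFLEX FIELD OF A CM POINT OF RSZ'S MODULI PROBLEM** (a pair `(A, ι : F → End⁰A)`, `F` a CM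
field, `[F : ℚ] = 2 dim A`, with the Kottwitz condition of signature `((1, n−1)_{φ₀}, (0, n)_{φ ∈ Φ₀ ∖ {φ₀}})` on `Lie(A)`,
`n = [F : K₀] ≥ 3`, `K₀` of any degree) is the compositum of the reflex field `E_{Φ₀}` of the base type and the image
`σ₀(F)` of the special element.  Howard's «`K_Φ = φ^{sp}(K)`» for `K₀` imaginary quadratic.
[cite: Howard2012, §3.1] [cite: RapoportSmithlingZhang2017, §3.1 eq. (3.1) and §3.2] [cite: Shimura1998, §8.3 Prop. 28] -/
theorem traceField_cmTypeOfPair_eq_traceField_sup_fieldRange_of_rsz (h3 : 3 ≤ finrank K₀ F) {σ₀ : F →+* ℂ}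
    (hσ₀ : σ₀ ∈ (cmTypeOfPair ιF hF).1) (hσ₀ψ : σ₀.comp (algebraMap K₀ F) = φ₀) :
    traceField (cmTypeOfPair ιF hF) = traceField Φ₀ ⊔ σ₀.toRatAlgHom.fieldRange :=
  traceField_eq_traceField_sup_fieldRange_of_rsz K₀ hφ₀ (h1_ncard_rc3 ιF hF K₀ Φ₀ hφ₀ h)
    (hΦ₀_ncard_rc3 ιF hF K₀ Φ₀ hφ₀ h) h3 hσ₀ hσ₀ψ

include hφ₀ h in
/-- **`E_{Φ₀} ⊆ K*`** — the reflex field of the base type (of RSZ's torus `Z^ℚ`, Remark 3.1 (i)) lies in the reflex field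
of the CM point. [cite: RapoportSmithlingZhang2017, §3.1 Remark 3.1 (i)] [cite: Shimura1998, §8.3 Prop. 28] -/
theorem traceField_base_le_traceField_cmTypeOfPair_of_rsz (h3 : 3 ≤ finrank K₀ F) :
    traceField Φ₀ ≤ traceField (cmTypeOfPair ιF hF) :=
  traceField_base_le_traceField_of_rsz K₀ hφ₀ (h1_ncard_rc3 ιF hF K₀ Φ₀ hφ₀ h) (hΦ₀_ncard_rc3 ιF hF K₀ Φ₀ hφ₀ h) h3

include hφ₀ h in
/-- **RSZ's REFLEX FIELD `E = E_{Φ₀} · φ₀(K₀)` LIES IN `K*`** — the reflex field of the Shimura datum is contained in the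
reflex field of (THE type of) every CM point of the moduli problem with `n ≥ 3`.
[cite: RapoportSmithlingZhang2017, §3.1 eq. (3.1) and §3.2] [cite: Howard2012, §3.1] -/
theorem traceField_sup_fieldRange_le_traceField_cmTypeOfPair_of_rsz (h3 : 3 ≤ finrank K₀ F) :
    traceField Φ₀ ⊔ φ₀.toRatAlgHom.fieldRange ≤ traceField (cmTypeOfPair ιF hF) :=
  traceField_sup_fieldRange_le_traceField_of_rsz K₀ hφ₀ (h1_ncard_rc3 ιF hF K₀ Φ₀ hφ₀ h)
    (hΦ₀_ncard_rc3 ιF hF K₀ Φ₀ hφ₀ h) h3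

include hφ₀ h in
/-- `Aut(ℂ/K*) ≤ Aut(ℂ/E)`: an automorphism of `ℂ` fixing the CM point's reflex field stabilises `Φ₀` and fixes `φ₀`.
[cite: RapoportSmithlingZhang2017, §3.1 eq. (3.1)] [cite: Shimura1998, §8.3 Prop. 28] -/
theorem forall_smul_mem_base_iff_and_smul_eq_of_forall_apply_traceField_cmTypeOfPair_eq (h3 : 3 ≤ finrank K₀ F)
    {τ : ℂ ≃+* ℂ} (hτ : ∀ z : ℂ, z ∈ traceField (cmTypeOfPair ιF hF) → τ z = z) :
    (∀ ψ : K₀ →+* ℂ, τ • ψ ∈ Φ₀.1 ↔ ψ ∈ Φ₀.1) ∧ τ • φ₀ = φ₀ :=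
  forall_smul_mem_iff_base_and_smul_eq_of_forall_apply_traceField_eq K₀ hφ₀ (h1_ncard_rc3 ιF hF K₀ Φ₀ hφ₀ h)
    (hΦ₀_ncard_rc3 ιF hF K₀ Φ₀ hφ₀ h) h3 hτ

include hφ₀ h in
/-- **`K*` IS THE FIXED FIELD OF `Stab(Φ₀) ∩ Stab(σ₀)`.** [cite: RapoportSmithlingZhang2017, §3.1 eq. (3.1) and §3.2]
[cite: Howard2012, §3.1] -/
theorem mem_traceField_cmTypeOfPair_iff_forall_of_rsz (h3 : 3 ≤ finrank K₀ F) {σ₀ : F →+* ℂ}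
    (hσ₀ : σ₀ ∈ (cmTypeOfPair ιF hF).1) (hσ₀ψ : σ₀.comp (algebraMap K₀ F) = φ₀) (z : ℂ) :
    z ∈ traceField (cmTypeOfPair ιF hF) ↔
      ∀ τ : ℂ ≃+* ℂ, (∀ ψ : K₀ →+* ℂ, τ • ψ ∈ Φ₀.1 ↔ ψ ∈ Φ₀.1) → τ • σ₀ = σ₀ → τ z = z :=
  mem_traceField_iff_forall_of_rsz K₀ hφ₀ (h1_ncard_rc3 ιF hF K₀ Φ₀ hφ₀ h) (hΦ₀_ncard_rc3 ιF hF K₀ Φ₀ hφ₀ h) h3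
    hσ₀ hσ₀ψ z

include hφ₀ h hF in
/-- **`2 dim A ∣ [K* : ℚ]`** (`σ₀(F) ⊆ K*`, `[σ₀(F) : ℚ] = [F : ℚ] = 2 dim A`; g27-#5 has `≤`). [cite: Howard2012, §3.1]
[cite: MilneFT2022, Prop. 1.20] -/
theorem two_mul_dim_dvd_finrank_traceField_of_rsz (h3 : 3 ≤ finrank K₀ F) :
    2 * A.dim ∣ finrank ℚ (traceField (cmTypeOfPair ιF hF)) := by
  rw [← hF]
  exact finrank_dvd_finrank_traceField_of_rsz K₀ (h1_ncard_rc3 ιF hF K₀ Φ₀ hφ₀ h) (hΦ₀_ncard_rc3 ιF hF K₀ Φ₀ hφ₀ h) h3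

include hφ₀ h in
/-- **`[E_{Φ₀} : ℚ] ∣ [K* : ℚ]`.** [cite: RapoportSmithlingZhang2017, §3.1 Remark 3.1 (i)] [cite: MilneFT2022, Prop. 1.20] -/
theorem finrank_traceField_base_dvd_finrank_traceField_cmTypeOfPair_of_rsz (h3 : 3 ≤ finrank K₀ F) :
    finrank ℚ (traceField Φ₀) ∣ finrank ℚ (traceField (cmTypeOfPair ιF hF)) :=
  finrank_traceField_base_dvd_of_rsz K₀ hφ₀ (h1_ncard_rc3 ιF hF K₀ Φ₀ hφ₀ h) (hΦ₀_ncard_rc3 ιF hF K₀ Φ₀ hφ₀ h) h3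

include hφ₀ h in
/-- **`[E : ℚ] ∣ [K* : ℚ]`** for RSZ's `E = E_{Φ₀} · φ₀(K₀)`. [cite: RapoportSmithlingZhang2017, §3.1 eq. (3.1)]
[cite: MilneFT2022, Prop. 1.20] -/
theorem finrank_traceField_sup_fieldRange_dvd_finrank_traceField_cmTypeOfPair_of_rsz (h3 : 3 ≤ finrank K₀ F) :
    finrank ℚ (traceField Φ₀ ⊔ φ₀.toRatAlgHom.fieldRange : IntermediateField ℚ ℂ) ∣
      finrank ℚ (traceField (cmTypeOfPair ιF hF)) :=
  finrank_traceField_sup_fieldRange_dvd_of_rsz K₀ hφ₀ (h1_ncard_rc3 ιF hF K₀ Φ₀ hφ₀ h)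
    (hΦ₀_ncard_rc3 ιF hF K₀ Φ₀ hφ₀ h) h3

include hφ₀ h hF in
/-- **`[K* : ℚ] ≤ [E_{Φ₀} : ℚ] · 2 dim A`** (degree of the compositum). [cite: MilneFT2022, Cor. 3.19] [cite: Howard2012, §3.1] -/
theorem finrank_traceField_cmTypeOfPair_le_of_rsz (h3 : 3 ≤ finrank K₀ F) :
    finrank ℚ (traceField (cmTypeOfPair ιF hF)) ≤ finrank ℚ (traceField Φ₀) * (2 * A.dim) := by
  rw [← hF]
  exact finrank_traceField_le_mul_of_rsz K₀ hφ₀ (h1_ncard_rc3 ιF hF K₀ Φ₀ hφ₀ h) (hΦ₀_ncard_rc3 ιF hF K₀ Φ₀ hφ₀ h) h3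

include hφ₀ h in
/-- **`K* = σ₀(F)` iff `E_{Φ₀} ⊆ σ₀(F)`** — the correction to Howard's formula is the reflex field of the base type
(g27-#5's `traceField_cmTypeOfPair_eq_fieldRange_of_rsz` is the case `K₀/ℚ` normal). [cite: Howard2012, §3.1]
[cite: RapoportSmithlingZhang2017, §3.1 Remark 3.1 (i)] -/
theorem traceField_cmTypeOfPair_eq_fieldRange_iff_of_rsz (h3 : 3 ≤ finrank K₀ F) {σ₀ : F →+* ℂ}
    (hσ₀ : σ₀ ∈ (cmTypeOfPair ιF hF).1) (hσ₀ψ : σ₀.comp (algebraMap K₀ F) = φ₀) :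
    traceField (cmTypeOfPair ιF hF) = σ₀.toRatAlgHom.fieldRange ↔ traceField Φ₀ ≤ σ₀.toRatAlgHom.fieldRange :=
  traceField_eq_fieldRange_iff_of_rsz K₀ hφ₀ (h1_ncard_rc3 ιF hF K₀ Φ₀ hφ₀ h) (hΦ₀_ncard_rc3 ιF hF K₀ Φ₀ hφ₀ h) h3
    hσ₀ hσ₀ψ

include hφ₀ h in
/-- `K* = σ₀(F)` iff `Stab(σ₀) ≤ Stab(Φ₀)` in `Aut(ℂ)`. [cite: Howard2012, §3.1] [cite: Shimura1998, §8.3 Prop. 28] -/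
theorem traceField_cmTypeOfPair_eq_fieldRange_iff_forall_of_rsz (h3 : 3 ≤ finrank K₀ F) {σ₀ : F →+* ℂ}
    (hσ₀ : σ₀ ∈ (cmTypeOfPair ιF hF).1) (hσ₀ψ : σ₀.comp (algebraMap K₀ F) = φ₀) :
    traceField (cmTypeOfPair ιF hF) = σ₀.toRatAlgHom.fieldRange ↔
      ∀ τ : ℂ ≃+* ℂ, τ • σ₀ = σ₀ → ∀ ψ : K₀ →+* ℂ, τ • ψ ∈ Φ₀.1 ↔ ψ ∈ Φ₀.1 :=
  traceField_eq_fieldRange_iff_forall_of_rsz K₀ hφ₀ (h1_ncard_rc3 ιF hF K₀ Φ₀ hφ₀ h)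
    (hΦ₀_ncard_rc3 ιF hF K₀ Φ₀ hφ₀ h) h3 hσ₀ hσ₀ψ

include hφ₀ h hF in
/-- **With the special element supplied by the condition**: there is `σ₀ ∈ Φ` above `φ₀` with `K* = E_{Φ₀} · σ₀(F)` and
`[σ₀(F) : ℚ] = 2 dim A`. [cite: RapoportSmithlingZhang2017, §3.2] [cite: Howard2012, §3.1] -/
theorem exists_special_traceField_cmTypeOfPair_eq_of_rsz (h3 : 3 ≤ finrank K₀ F) :
    ∃ σ₀ ∈ (cmTypeOfPair ιF hF).1, σ₀.comp (algebraMap K₀ F) = φ₀ ∧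
      traceField (cmTypeOfPair ιF hF) = traceField Φ₀ ⊔ σ₀.toRatAlgHom.fieldRange ∧
        finrank ℚ σ₀.toRatAlgHom.fieldRange = 2 * A.dim := by
  obtain ⟨σ₀, hσ₀, hσ₀ψ, -⟩ := exists_special_of_rsz ιF hF K₀ Φ₀ hφ₀ h
  exact ⟨σ₀, hσ₀, hσ₀ψ, traceField_cmTypeOfPair_eq_traceField_sup_fieldRange_of_rsz ιF hF K₀ Φ₀ hφ₀ h h3 hσ₀ hσ₀ψ,
    finrank_fieldRange_rc3 hF σ₀⟩

end RSZ

/-! ### §3 Through the Harris–Taylor hypotheses in multiplicity form -/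

section HarrisTaylor

variable [IsCMField F] {φ₀ : K₀ →+* ℂ}
  (h1 : Fintype.card {σ : (cmTypeOfPair ιF hF).1 // σ.1.comp (algebraMap K₀ F) = φ₀} = 1)
  (hban : ∀ ψ : K₀ →+* ℂ, ψ ≠ φ₀ → ψ ≠ ComplexEmbedding.conjugate φ₀ →
    Fintype.card {σ : (cmTypeOfPair ιF hF).1 // σ.1.comp (algebraMap K₀ F) = ψ} = 0 ∨
      Fintype.card {σ : (cmTypeOfPair ιF hF).1 // σ.1.comp (algebraMap K₀ F) = ψ} = finrank K₀ F)

omit [IsCMField F] in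
include h1 in
/-- `h1` in the field-level spelling. [folklore] -/
private theorem h1_ncard_rc3' : {φ : F →+* ℂ | φ ∈ (cmTypeOfPair ιF hF).1 ∧ φ.comp (algebraMap K₀ F) = φ₀}.ncard = 1 := by
  rw [ncard_inter_fibre_eq_card_fibre_rc3 ιF hF K₀, h1]

omit [IsCMField F] in
include hban in
/-- `hban` in the field-level spelling. [folklore] -/
private theorem hban_ncard_rc3' : ∀ ψ : K₀ →+* ℂ, ψ ≠ φ₀ → ψ ≠ ComplexEmbedding.conjugate φ₀ →
    {φ : F →+* ℂ | φ ∈ (cmTypeOfPair ιF hF).1 ∧ φ.comp (algebraMap K₀ F) = ψ}.ncard = 0 ∨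
      {φ : F →+* ℂ | φ ∈ (cmTypeOfPair ιF hF).1 ∧ φ.comp (algebraMap K₀ F) = ψ}.ncard = finrank K₀ F := by
  intro ψ hψ0 hψ1
  rw [ncard_inter_fibre_eq_card_fibre_rc3 ιF hF K₀]
  exact hban ψ hψ0 hψ1

include h1 hban in
/-- **A CM point with the Harris–Taylor multiplicities (`m_{φ₀} = 1`, `m_ψ ∈ {0, n}` off `{φ₀, φ̄₀}`; `n ≥ 3`) has a base type
`Φ₀ ∋ φ₀` with `K* = E_{Φ₀} · σ₀(F)` and `E_{Φ₀} · φ₀(K₀) ⊆ K*`.** [cite: Howard2012, §3.1] [cite: RapoportSmithlingZhang2017, §3.1 eq. (3.1)] -/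
theorem exists_cmType_traceField_cmTypeOfPair_eq_of_harrisTaylor (h3 : 3 ≤ finrank K₀ F) {σ₀ : F →+* ℂ}
    (hσ₀ : σ₀ ∈ (cmTypeOfPair ιF hF).1) (hσ₀ψ : σ₀.comp (algebraMap K₀ F) = φ₀) :
    ∃ Φ₀ : CMType K₀, φ₀ ∈ Φ₀.1 ∧ traceField (cmTypeOfPair ιF hF) = traceField Φ₀ ⊔ σ₀.toRatAlgHom.fieldRange ∧
      traceField Φ₀ ⊔ φ₀.toRatAlgHom.fieldRange ≤ traceField (cmTypeOfPair ιF hF) :=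
  exists_cmType_traceField_eq_of_harrisTaylor K₀ (h1_ncard_rc3' ιF hF K₀ h1) (hban_ncard_rc3' ιF hF K₀ hban) h3 hσ₀ hσ₀ψ

include h1 hban in
/-- **`K*` is the fixed field of `Stab(m) ∩ Stab(σ₀)`** for such a CM point (`n ≥ 3`). [cite: Howard2012, §3.1]
[cite: RapoportSmithlingZhang2017, §3.1 eq. (3.1)] -/
theorem mem_traceField_cmTypeOfPair_iff_forall_of_harrisTaylor (h3 : 3 ≤ finrank K₀ F) {σ₀ : F →+* ℂ}
    (hσ₀ : σ₀ ∈ (cmTypeOfPair ιF hF).1) (hσ₀ψ : σ₀.comp (algebraMap K₀ F) = φ₀) (z : ℂ) :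
    z ∈ traceField (cmTypeOfPair ιF hF) ↔
      ∀ τ : ℂ ≃+* ℂ, (∀ ψ : K₀ →+* ℂ,
          Fintype.card {σ : (cmTypeOfPair ιF hF).1 // σ.1.comp (algebraMap K₀ F) = τ • ψ} =
            Fintype.card {σ : (cmTypeOfPair ιF hF).1 // σ.1.comp (algebraMap K₀ F) = ψ}) → τ • σ₀ = σ₀ → τ z = z := by
  rw [mem_traceField_iff_forall_of_harrisTaylor K₀ (h1_ncard_rc3' ιF hF K₀ h1) (hban_ncard_rc3' ιF hF K₀ hban) h3 hσ₀
    hσ₀ψ z]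
  simp only [ncard_inter_fibre_eq_card_fibre_rc3 ιF hF K₀]

include h1 hban hF in
/-- **`2 dim A ∣ [K* : ℚ]`** for such a CM point (`n ≥ 3`; g27-#5 has `≤`). [cite: Howard2012, §3.1] [cite: MilneFT2022, Prop. 1.20] -/
theorem two_mul_dim_dvd_finrank_traceField_of_harrisTaylor (h3 : 3 ≤ finrank K₀ F) :
    2 * A.dim ∣ finrank ℚ (traceField (cmTypeOfPair ιF hF)) := by
  rw [← hF]
  exact finrank_dvd_finrank_traceField_of_harrisTaylor K₀ (h1_ncard_rc3' ιF hF K₀ h1) (hban_ncard_rc3' ιF hF K₀ hban) h3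

end HarrisTaylor

end EndFieldFullDegree

end Literature.AlgebraicGeometry.ComplexMultiplication

end
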